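import Mathlib
import Summits.Ventures.PercRepro2.BStarModel
import Summits.Ventures.PercRepro2.BStarCert0
import Summits.Ventures.PercRepro2.BStarCert1
import Summits.Ventures.PercRepro2.BStarCert2
import Summits.Ventures.PercRepro2.BStarCert3

/-!
# The b-star certificate, assembled (blind cell PercRepro2, mine-2 g39, 2026-08-28;
`proofs/MINE2-GLUE.md` §2, row M2-83)

The four kernel-decided certificates `certb0 … certb3` (one per type of the edge `b–a₁`; every
type of `b–a₂`, `b–o`; every SORTED triple of `Q`-patterns) are put together:
`Cb_nonneg_sorted` (every typing `≤ 3`), `Cb_nonneg_validQ` (every ORDERED triple of `Q`-patterns,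
by the symmetry of the gadget sum in its patterns and a sort), and **`Cb_nonneg`** — the gadget sum
is nonnegative on every typing and every triple of set partitions of the four marks, a pattern
joining the roots contributing `0` (`Cb_eq_zero_of_p12`).  Own code; standard axioms.
-/

namespace Summit.Ventures.PercRepro2

namespace CovForm

namespace OStar

/-- The sorted certificate for every typing with types `≤ 3`. -/
theorem Cb_nonneg_sorted {t₁ t₂ tb : ℕ} (h₁ : t₁ ≤ 3) (h₂ : t₂ ≤ 3) (hb : tb ≤ 3)
    {P₁ P₂ P₃ : Pat} (v₁ : validQ P₁ = true) (v₂ : validQ P₂ = true) (v₃ : validQ P₃ = true)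
    (k₁₂ : key P₁ ≤ key P₂) (k₂₃ : key P₂ ≤ key P₃) : 0 ≤ Cb t₁ t₂ tb P₁ P₂ P₃ := by
  obtain ⟨b₁, b₂, b₃, b₄, b₅, b₆⟩ := P₁
  obtain ⟨c₁, c₂, c₃, c₄, c₅, c₆⟩ := P₂
  obtain ⟨d₁, d₂, d₃, d₄, d₅, d₆⟩ := P₃
  interval_cases t₁
  · exact certb0 ⟨t₂, by omega⟩ ⟨tb, by omega⟩ b₁ b₂ b₃ b₄ b₅ b₆ v₁ c₁ c₂ c₃ c₄ c₅ c₆ v₂ k₁₂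
      d₁ d₂ d₃ d₄ d₅ d₆ v₃ k₂₃
  · exact certb1 ⟨t₂, by omega⟩ ⟨tb, by omega⟩ b₁ b₂ b₃ b₄ b₅ b₆ v₁ c₁ c₂ c₃ c₄ c₅ c₆ v₂ k₁₂
      d₁ d₂ d₃ d₄ d₅ d₆ v₃ k₂₃
  · exact certb2 ⟨t₂, by omega⟩ ⟨tb, by omega⟩ b₁ b₂ b₃ b₄ b₅ b₆ v₁ c₁ c₂ c₃ c₄ c₅ c₆ v₂ k₁₂
      d₁ d₂ d₃ d₄ d₅ d₆ v₃ k₂₃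
  · exact certb3 ⟨t₂, by omega⟩ ⟨tb, by omega⟩ b₁ b₂ b₃ b₄ b₅ b₆ v₁ c₁ c₂ c₃ c₄ c₅ c₆ v₂ k₁₂
      d₁ d₂ d₃ d₄ d₅ d₆ v₃ k₂₃

/-- The certificate on every ordered triple of `Q`-patterns: sort the patterns, then use the
symmetry of the gadget sum. -/
theorem Cb_nonneg_validQ {t₁ t₂ tb : ℕ} (h₁ : t₁ ≤ 3) (h₂ : t₂ ≤ 3) (hb : tb ≤ 3)
    {P₁ P₂ P₃ : Pat} (v₁ : validQ P₁ = true) (v₂ : validQ P₂ = true) (v₃ : validQ P₃ = true) :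
    0 ≤ Cb t₁ t₂ tb P₁ P₂ P₃ := by
  obtain ⟨e12, e23, e231, e312, e321⟩ := Cb_perm t₁ t₂ tb P₁ P₂ P₃
  rcases le_total (key P₁) (key P₂) with h12 | h21 <;>
    rcases le_total (key P₂) (key P₃) with h23 | h32 <;>
    rcases le_total (key P₁) (key P₃) with h13 | h31
  · exact Cb_nonneg_sorted h₁ h₂ hb v₁ v₂ v₃ h12 h23
  · exact Cb_nonneg_sorted h₁ h₂ hb v₁ v₂ v₃ h12 h23
  · rw [e23]; exact Cb_nonneg_sorted h₁ h₂ hb v₁ v₃ v₂ h13 h32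
  · rw [e312]; exact Cb_nonneg_sorted h₁ h₂ hb v₃ v₁ v₂ h31 h12
  · rw [e12]; exact Cb_nonneg_sorted h₁ h₂ hb v₂ v₁ v₃ h21 h13
  · rw [e231]; exact Cb_nonneg_sorted h₁ h₂ hb v₂ v₃ v₁ h23 h31
  · rw [e321]; exact Cb_nonneg_sorted h₁ h₂ hb v₃ v₂ v₁ h32 h21
  · rw [e321]; exact Cb_nonneg_sorted h₁ h₂ hb v₃ v₂ v₁ h32 h21

/-- **The b-star certificate**: the gadget sum is nonnegative on every typing with types `≤ 3`
and every triple of set partitions of the four marks. -/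
theorem Cb_nonneg {t₁ t₂ tb : ℕ} (h₁ : t₁ ≤ 3) (h₂ : t₂ ≤ 3) (hb : tb ≤ 3)
    {P₁ P₂ P₃ : Pat} (v₁ : valid P₁ = true) (v₂ : valid P₂ = true) (v₃ : valid P₃ = true) :
    0 ≤ Cb t₁ t₂ tb P₁ P₂ P₃ := by
  by_cases q₁ : P₁.1 = true
  · rw [Cb_eq_zero_of_p12 t₁ t₂ tb (Or.inl q₁)]
  by_cases q₂ : P₂.1 = true
  · rw [Cb_eq_zero_of_p12 t₁ t₂ tb (Or.inr (Or.inl q₂))]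
  by_cases q₃ : P₃.1 = true
  · rw [Cb_eq_zero_of_p12 t₁ t₂ tb (Or.inr (Or.inr q₃))]
  refine Cb_nonneg_validQ h₁ h₂ hb ?_ ?_ ?_
  · simp [validQ, v₁, q₁]
  · simp [validQ, v₂, q₂]
  · simp [validQ, v₃, q₃]

end OStar

end CovForm

end Summit.Ventures.PercRepro2
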